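import Summits.NavierStokesRegularity.FluidComputer.GateBudgetLadder
import Summits.NavierStokesRegularity.FluidComputer.GateBudgetRungFine
import HarnessLib

/-!
# What no tuning can beat, part 67: THE FINE MISFIRE LADDER — part 64's ladder (20′d′) run on the
# fine rung map of part 66: the headline member misfires `N` times in a row for every `N` with
# `(N - 1)·286/K⁹ ≤ 0.144` and `0.00806 + N·(0.3(δ₀ + 310 log K/K⁹) + 6/K⁹) ≤ 1/50` — `N` up
# to `≍ 1.3·10⁻⁴K⁹/log K` for small lattice index (`≈ 3.1·10⁶` at `K = 16`, `22 ×` part 64's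
# `1.4·10⁵`; the scaling is `K⁹/log K`, not `K⁸`) — and its output stays below `0.1415` until
# `N + 1.83` (law 3′ of SPEC-INPUT-bp1 §BE)

Cell `pub-fluidc`, blueprint seat bp1 (gen 35, sixth item, file 3 of 3); same namespace and
conventions as parts 1–66 (`GateBudget*.lean`); imports part 64 (`GateBudgetLadder`: §199
`knob_ladder_anchor`, the first re-ignition of part 49 in normal form with `P ≤ 0.00806`) and
part 66 (`GateBudgetRungFine`: §207 `knob_rung_succ_fine`; through it part 63 §196
`rung_numerics` and the knob toolkit `RotorKnob.e_nonneg`,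
`RotorKnob.rotorCircuit_output_monotone`).
Headline knob family `rotorCircuit K K¹⁰ ε ρ` from (5.6) (modes `0 = a`, `1 = b` clock, `2 = c`
trigger, `3 = d`, `4 = ã` output), a trigger primitive `C` (`C' = c`), the lattice `ε = kK¹⁰ρ²`
on the window `200ε/K²⁰ ≤ ρ² ≤ 2ε/K¹⁰`, `δ₀ = kπ/((25/16 - 10⁻⁶)K¹⁰ - 1) + 1/K¹⁹`. HONEST
FRAMING (verbatim): low prior, high value-of-information experiment on Tao's machine paradigm;
NOT a claim that NS blows up. Nothing is proved about the Navier–Stokes equations.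

## Why (SPEC-INPUT-bp1 §BE: the budget with the pulse length kept at `241 log K/K¹⁰`)

Part 64's induction is generic in the rung map; only the per-rung pair increment changes, from
`s = 0.3(δ₀ + 1210/K⁸) + 6/K⁹` to `s′ = 0.3(δ₀ + 310 log K/K⁹) + 6/K⁹` (part 66 §207). The
proofs below are part 64 §198/§200/§201 with `knob_rung_succ_fine` for `knob_rung_succ`; the
anchor §199 is imported. BUDGET LINES (estimates, not theorems): `N ≤ 0.01194/s′`; for `k ≲ K`
(`0.3δ₀ ≲ 0.6k/K¹⁰`) `s′ ≈ (93 log K + 6)/K⁹`, i.e. `N ≍ 1.28·10⁻⁴K⁹/(log K + 0.065)`: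
`3.1·10⁶` at `K = 16` (part 64: `1.4·10⁵`), `2.5·10¹³` at `K = 100` (part 64: `3.3·10¹¹`); the
clock window allows `5.0·10⁻⁴K⁹` and is now only a factor `≈ 4 log K` above the pair ledger;
at the top of the lattice window (`k ≍ K¹⁰/200`, `δ₀ ≈ 0.01`) still `N ≈ 4`.

## What is proved

* §208 `knob_ladder_climb_fine`: part 64 §198 with `s′`.
* §209 `knob_misfire_ladder_fine` (THE FINE LADDER): part 64 §200 with `s′`, plus the pulse
  facts `T' - rₙ ≤ 241 log K/K¹⁰` and `ã(T') ≤ ã(rₙ) + K·(241 log K/K¹⁰)` at every rung.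
* §210 `knob_ladder_no_output_fine`: `ã ≤ 0.1415` on `[0, N + 1.8282]` under §209's budgets.

HONEST LIMITS. (i) The pair increment is still ABSOLUTE in kind (`K ×` pulse length, part 66
(i)); the remaining levers are a phase-resolved output law and a relative cold-phase dose (the
`6/K⁹` of part 57 §172), neither attempted; (ii) the pin slip `0.3δ₀ ≈ 0.6k/K¹⁰` per rung now
dominates for `k ≳ 150 log K·K`, and caps the ladder at `≈ 0.02K¹⁰/k` rungs there; (iii) every
limit of part 64 stands (`P₁ ≤ 0.00806` from part 49, headline family `M = K¹⁰`, `K ≥ 16`,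
lattice only, nothing claimed after rung `N`); (iv) nothing about Navier–Stokes.
[cite: Tao2016AveragedNS, §5.5 Theorem 5.3, (5.5), (5.6), (b-eq), (c-eq), (ta-eq), (energy-con)]
-/

noncomputable section

namespace Summit.NavierStokesRegularity.FluidComputer.GateBudget

open Real Set
open Literature.Analysis.FluidPDE.Tao2016AveragedNS

variable {K ε ρ : ℝ} {X : ℝ → Fin 5 → ℝ}

/-! ## §208 The generic climb, fine -/

/-- §208 THE GENERIC CLIMB, FINE (induction on the rung index with part 66's fine rung map §207;
part 64 §198 verbatim with `s′ = 0.3(δ₀ + 310 log K/K⁹) + 6/K⁹`). Headline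
member with a trigger primitive on the lattice window; an ignition `r₀ ≥ 0` in normal form
`b(r₀) = θ₀ε`, `c(r₀) = ρ²/K⁹`, `P(r₀) ≤ P₁`, with `5/4 + (N - 1)·286/K⁹ ≤ θ₀ ≤ 29/20`,
`(N - 1)·286/K⁹ ≤ 0.14999` and `P₁ + N·s ≤ 1/50` ⇒ for every `1 ≤ n ≤ N` an ignition
`rₙ ≥ r₀ + (n - 1)` with `b(rₙ) = θₙε`, `5/4 + (N - n)·286/K⁹ ≤ θₙ ≤ 29/20`, `c(rₙ) = ρ²/K⁹`,
`P(rₙ) ≤ P₁ + (n - 1)s′`. [derived: part 66 §207, `Nat.le_induction`] -/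
theorem knob_ladder_climb_fine
    (hX : ∀ t, HasDerivAt X (RotorKnob.rotorCircuit K (K ^ 10) ε ρ (X t)) t)
    (h0 : X 0 = delayInit) {C : ℝ → ℝ} (hC : ∀ t, HasDerivAt C (X t 2) t) (hK : 16 ≤ K)
    (hε : 0 < ε) (hεK : ε ^ 2 ≤ 1 / (6 * K ^ 20)) (hρ : 0 < ρ)
    (hlo : 200 * ε / K ^ 20 ≤ ρ ^ 2) (hhi : K ^ 10 * ρ ^ 2 ≤ 2 * ε) (k : ℕ)
    (hk : ε = k * K ^ 10 * ρ ^ 2) {r₀ θ₀ P₁ : ℝ} {N : ℕ} (hr₀ : 0 ≤ r₀)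
    (hb₀ : X r₀ 1 = θ₀ * ε) (hc₀ : X r₀ 2 = ρ ^ 2 / K ^ 9) (hP₁ : X r₀ 3 ^ 2 + X r₀ 4 ^ 2 ≤ P₁)
    (hθ₀lo : 5 / 4 + ((N : ℝ) - 1) * (286 / K ^ 9) ≤ θ₀) (hθ₀hi : θ₀ ≤ 29 / 20)
    (hNθ : ((N : ℝ) - 1) * (286 / K ^ 9) ≤ 14999 / 100000)
    (hNP : P₁ + (N : ℝ) * (3 * (k * π / ((25 / 16 - 1 / 10 ^ 6) * K ^ 10 - 1) + 1 / K ^ 19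
      + 310 * log K / K ^ 9) / 10 + 6 / K ^ 9) ≤ 1 / 50) :
    ∀ n : ℕ, 1 ≤ n → n ≤ N → ∃ r θ : ℝ, r₀ + ((n : ℝ) - 1) ≤ r ∧ X r 1 = θ * ε ∧
      5 / 4 + ((N : ℝ) - n) * (286 / K ^ 9) ≤ θ ∧ θ ≤ 29 / 20 ∧ X r 2 = ρ ^ 2 / K ^ 9 ∧
      X r 3 ^ 2 + X r 4 ^ 2 ≤ P₁ + ((n : ℝ) - 1) * (3 * (k * π / ((25 / 16 - 1 / 10 ^ 6)
        * K ^ 10 - 1) + 1 / K ^ 19 + 310 * log K / K ^ 9) / 10 + 6 / K ^ 9) := by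
  obtain ⟨-, -, -, hδ0, -, -⟩ := rung_numerics hK hε hρ hlo k hk
  have hK0 : (0 : ℝ) < K := by linarith
  have h286 : (0 : ℝ) ≤ 286 / K ^ 9 := by positivity
  have h310 : (0 : ℝ) ≤ 310 * log K / K ^ 9 :=
    div_nonneg (mul_nonneg (by norm_num) (Real.log_nonneg (by linarith))) (by positivity)
  have h6 : (0 : ℝ) ≤ 6 / K ^ 9 := by positivity
  obtain ⟨s, hs_def⟩ : ∃ s : ℝ, s = 3 * (k * π / ((25 / 16 - 1 / 10 ^ 6) * K ^ 10 - 1)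
      + 1 / K ^ 19 + 310 * log K / K ^ 9) / 10 + 6 / K ^ 9 := ⟨_, rfl⟩
  have hs0 : 0 ≤ s := by rw [hs_def]; linarith only [hδ0, h310, h6]
  simp only [← hs_def] at hNP ⊢
  intro n hn
  induction n, hn using Nat.le_induction with
  | base =>
    intro _
    exact ⟨r₀, θ₀, by simp, hb₀, by simpa using hθ₀lo, hθ₀hi, hc₀, by simpa using hP₁⟩
  | succ m hm ih =>
    intro hmN
    obtain ⟨r, θ, hr, hb, hθlo, hθhi, hc, hP⟩ := ih (Nat.le_of_succ_le hmN)
    have hm1 : (1 : ℝ) ≤ m := by exact_mod_cast hm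
    have hmN' : (m : ℝ) + 1 ≤ N := by exact_mod_cast hmN
    have hNm : 0 ≤ ((N : ℝ) - m) * (286 / K ^ 9) := mul_nonneg (by linarith) h286
    have hmq : 0 ≤ (m : ℝ) * (286 / K ^ 9) := mul_nonneg (by linarith) h286
    have hr0 : 0 ≤ r := by linarith only [hr₀, hr, hm1]
    have hθ1 : 5 / 4 ≤ θ := by linarith only [hθlo, hNm]
    have hms : ((m : ℝ) - 1) * s + s ≤ N * s := by nlinarith only [hs0, hmN']
    have key : X r 3 ^ 2 + X r 4 ^ 2 + s ≤ 1 / 50 := by linarith only [hP, hNP, hms]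
    have hPr : X r 3 ^ 2 + X r 4 ^ 2 + 3 * (k * π / ((25 / 16 - 1 / 10 ^ 6) * K ^ 10 - 1)
        + 1 / K ^ 19 + 310 * log K / K ^ 9) / 10 + 6 / K ^ 9 ≤ 1 / 50 := by
      rw [hs_def] at key; linarith only [key]
    obtain ⟨T', θ₁, tz, r', θ', -, ⟨-, -, -, -, -, hc'⟩, hb', hθ'hi, hθ'lo, hP', hrr'⟩ :=
      knob_rung_succ_fine hX h0 hC hK hε hεK hρ hlo hhi k hk hr0 hθ1 hθhi hb hc hPr
    have hP's : X r' 3 ^ 2 + X r' 4 ^ 2 ≤ X r 3 ^ 2 + X r 4 ^ 2 + s := by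
      rw [hs_def]; linarith only [hP']
    refine ⟨r', θ', ?_, hb', ?_, by linarith only [hθ'hi], ?_, ?_⟩
    · push_cast; linarith only [hr, hrr']
    · push_cast
      rcases hθ'lo with h | h
      · linarith only [hθlo, h]
      · linarith only [hNθ, h, hmq]
    · exact hc'
    · push_cast; linarith only [hP, hP's]

/-! ## §209 The misfire ladder, fine -/

/-- §209 THE MISFIRE LADDER, FINE (20′d′) with law 3′ (SPEC-INPUT-bp1 §BE). Headline member
from `delayInit` with a trigger primitive `C`, `K ≥ 16`, `0 < ε`, `ε² ≤ 1/(6K²⁰)`, `0 < ρ`,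
lattice window `200ε/K²⁰ ≤ ρ²`, `K¹⁰ρ² ≤ 2ε`, `ε = kK¹⁰ρ²`; any `N : ℕ` inside both budgets,
`(N - 1)·286/K⁹ ≤ 0.144` (clock window, as in part 64) and `0.00806 + N·s′ ≤ 1/50`,
`s′ = 0.3(δ₀ + 310 log K/K⁹) + 6/K⁹` (fine pair ledger). Then for every `1 ≤ n ≤ N` there is
an `n`-th ignition `rₙ > 1.8282 + n` in normal form (`b(rₙ) = θₙε`, `5/4 ≤ θₙ ≤ 29/20`,
`c(rₙ) = ρ²/K⁹`, `P(rₙ) + s′ ≤ 1/50`) whose pulse MISFIRES: there are `T' θ'` with `rₙ < T'`,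
`T' - rₙ ≤ 242/K⁹`, `T' - rₙ ≤ 241 log K/K¹⁰`, `b(T') = -θ'ε`, `θ' ≥ 5/4 - 10⁻⁸`, `c(T') ≤
2ρ²/K¹⁰`, `|(C(T') - C(rₙ))/ρ² - kπ| ≤ δ₀` and `ã(T') ≤ ã(rₙ) + K·(241 log K/K¹⁰)`.
[derived: this file §208 + part 64 §199 + part 66 §207; Tao2016AveragedNS (5.6)] -/
theorem knob_misfire_ladder_fine
    (hX : ∀ t, HasDerivAt X (RotorKnob.rotorCircuit K (K ^ 10) ε ρ (X t)) t)
    (h0 : X 0 = delayInit) {C : ℝ → ℝ} (hC : ∀ t, HasDerivAt C (X t 2) t) (hK : 16 ≤ K)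
    (hε : 0 < ε) (hεK : ε ^ 2 ≤ 1 / (6 * K ^ 20)) (hρ : 0 < ρ)
    (hlo : 200 * ε / K ^ 20 ≤ ρ ^ 2) (hhi : K ^ 10 * ρ ^ 2 ≤ 2 * ε) (k : ℕ)
    (hk : ε = k * K ^ 10 * ρ ^ 2) (N : ℕ)
    (hNθ : ((N : ℝ) - 1) * (286 / K ^ 9) ≤ 144 / 1000)
    (hNP : 806 / 100000 + (N : ℝ) * (3 * (k * π / ((25 / 16 - 1 / 10 ^ 6) * K ^ 10 - 1)
      + 1 / K ^ 19 + 310 * log K / K ^ 9) / 10 + 6 / K ^ 9) ≤ 1 / 50) :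
    ∀ n : ℕ, 1 ≤ n → n ≤ N → ∃ r θ T' θ' : ℝ,
      (18282 / 10000 + n < r ∧ X r 1 = θ * ε ∧ 5 / 4 ≤ θ ∧ θ ≤ 29 / 20 ∧
        X r 2 = ρ ^ 2 / K ^ 9 ∧
        X r 3 ^ 2 + X r 4 ^ 2 + (3 * (k * π / ((25 / 16 - 1 / 10 ^ 6) * K ^ 10 - 1)
          + 1 / K ^ 19 + 310 * log K / K ^ 9) / 10 + 6 / K ^ 9) ≤ 1 / 50) ∧
      (r < T' ∧ T' - r ≤ 242 / K ^ 9 ∧ T' - r ≤ 241 * log K / K ^ 10 ∧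
        X T' 1 = -(θ' * ε) ∧ 5 / 4 - 1 / 10 ^ 8 ≤ θ' ∧ X T' 2 ≤ 2 * ρ ^ 2 / K ^ 10 ∧
        |(C T' - C r) / ρ ^ 2 - k * π|
          ≤ k * π / ((25 / 16 - 1 / 10 ^ 6) * K ^ 10 - 1) + 1 / K ^ 19 ∧
        X T' 4 ≤ X r 4 + K * (241 * log K / K ^ 10)) := by
  obtain ⟨-, -, -, hδ0, -, h243⟩ := rung_numerics hK hε hρ hlo k hk
  have hK0 : (0 : ℝ) < K := by linarith
  have h286 : (0 : ℝ) ≤ 286 / K ^ 9 := by positivity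
  have h310 : (0 : ℝ) ≤ 310 * log K / K ^ 9 :=
    div_nonneg (mul_nonneg (by norm_num) (Real.log_nonneg (by linarith))) (by positivity)
  have h6 : (0 : ℝ) ≤ 6 / K ^ 9 := by positivity
  obtain ⟨r₁, θ₁, hr1, hb1, hθ1lo, hθ1hi, hc1, hP1⟩ :=
    knob_ladder_anchor hX h0 hC hK hε hεK hρ hlo hhi k hk
  have hclimb := knob_ladder_climb_fine hX h0 hC hK hε hεK hρ hlo hhi k hk (N := N)
    (by linarith only [hr1]) hb1 hc1 hP1 (by linarith only [hNθ, hθ1lo])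
    (by linarith only [hθ1hi]) (by linarith only [hNθ]) hNP
  obtain ⟨s, hs_def⟩ : ∃ s : ℝ, s = 3 * (k * π / ((25 / 16 - 1 / 10 ^ 6) * K ^ 10 - 1)
      + 1 / K ^ 19 + 310 * log K / K ^ 9) / 10 + 6 / K ^ 9 := ⟨_, rfl⟩
  have hs0 : 0 ≤ s := by rw [hs_def]; linarith only [hδ0, h310, h6]
  simp only [← hs_def] at hNP hclimb ⊢
  intro n hn hnN
  obtain ⟨r, θ, hr, hb, hθlo, hθhi, hc, hP⟩ := hclimb n hn hnN
  have hn1 : (1 : ℝ) ≤ n := by exact_mod_cast hn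
  have hnN' : (n : ℝ) ≤ N := by exact_mod_cast hnN
  have hNn : 0 ≤ ((N : ℝ) - n) * (286 / K ^ 9) := mul_nonneg (by linarith) h286
  have hθ1 : 5 / 4 ≤ θ := by linarith only [hθlo, hNn]
  have hr0 : 0 ≤ r := by linarith only [hr, hr1, hn1]
  have hns : ((n : ℝ) - 1) * s + s ≤ N * s := by nlinarith only [hs0, hnN']
  have key : X r 3 ^ 2 + X r 4 ^ 2 + s ≤ 1 / 50 := by linarith only [hP, hNP, hns]
  have hPr : X r 3 ^ 2 + X r 4 ^ 2 + 3 * (k * π / ((25 / 16 - 1 / 10 ^ 6) * K ^ 10 - 1)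
      + 1 / K ^ 19 + 310 * log K / K ^ 9) / 10 + 6 / K ^ 9 ≤ 1 / 50 := by
    rw [hs_def] at key; linarith only [key]
  obtain ⟨T', θ', tz, r', θn, ⟨hrT, hτ, hτf, -, hbT, hθ'lo, -, hcT, hpin, -, hã⟩, -, -⟩ :=
    knob_rung_succ_fine hX h0 hC hK hε hεK hρ hlo hhi k hk hr0 hθ1 hθhi hb hc hPr
  exact ⟨r, θ, T', θ', ⟨by linarith only [hr, hr1], hb, hθ1, hθhi, hc, key⟩,
    ⟨hrT, hτ, hτf, hbT, by linarith only [hθ'lo, hθ1, h243], hcT, hpin, hã⟩⟩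

/-! ## §210 No output while the fine ladder lasts -/

/-- §210 NO OUTPUT WHILE THE FINE LADDER LASTS: under the hypotheses of §209 with `1 ≤ N`, the
output gate satisfies `ã(t) ≤ 0.1415` for every `0 ≤ t ≤ N + 1.8282` (part 64 §201 verbatim on
the fine budget). [derived: this file §209 + RotorKnob.e_nonneg / rotorCircuit_output_monotone] -/
theorem knob_ladder_no_output_fine
    (hX : ∀ t, HasDerivAt X (RotorKnob.rotorCircuit K (K ^ 10) ε ρ (X t)) t)
    (h0 : X 0 = delayInit) {C : ℝ → ℝ} (hC : ∀ t, HasDerivAt C (X t 2) t) (hK : 16 ≤ K)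
    (hε : 0 < ε) (hεK : ε ^ 2 ≤ 1 / (6 * K ^ 20)) (hρ : 0 < ρ)
    (hlo : 200 * ε / K ^ 20 ≤ ρ ^ 2) (hhi : K ^ 10 * ρ ^ 2 ≤ 2 * ε) (k : ℕ)
    (hk : ε = k * K ^ 10 * ρ ^ 2) (N : ℕ) (hN : 1 ≤ N)
    (hNθ : ((N : ℝ) - 1) * (286 / K ^ 9) ≤ 144 / 1000)
    (hNP : 806 / 100000 + (N : ℝ) * (3 * (k * π / ((25 / 16 - 1 / 10 ^ 6) * K ^ 10 - 1)
      + 1 / K ^ 19 + 310 * log K / K ^ 9) / 10 + 6 / K ^ 9) ≤ 1 / 50) :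
    ∀ t ∈ Icc (0 : ℝ) (18282 / 10000 + N), X t 4 ≤ 1415 / 10000 := by
  obtain ⟨-, -, -, hδ0, -, -⟩ := rung_numerics hK hε hρ hlo k hk
  have hK0 : (0 : ℝ) < K := by linarith
  have h310 : (0 : ℝ) ≤ 310 * log K / K ^ 9 :=
    div_nonneg (mul_nonneg (by norm_num) (Real.log_nonneg (by linarith))) (by positivity)
  have h6 : (0 : ℝ) ≤ 6 / K ^ 9 := by positivity
  obtain ⟨r, θ, T', θ', ⟨hr, -, -, -, -, hP⟩, -⟩ :=
    knob_misfire_ladder_fine hX h0 hC hK hε hεK hρ hlo hhi k hk N hNθ hNP N hN le_rfl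
  intro t ht
  have hmono := RotorKnob.rotorCircuit_output_monotone hK0.le hX
  have h1 : X t 4 ≤ X r 4 := hmono (by linarith only [ht.2, hr])
  have hsq : X r 4 ^ 2 ≤ (1415 / 10000) ^ 2 := by
    nlinarith only [hP, sq_nonneg (X r 3), hδ0, h310, h6]
  exact h1.trans (abs_le_of_sq_le_sq' hsq (by norm_num)).2

end Summit.NavierStokesRegularity.FluidComputer.GateBudget

end
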